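import Mathlib
import Literature.Computability.Complexity.Circuit
import Literature.Computability.Complexity.CircuitSemantics
import Literature.Computability.Complexity.MonotoneNechiporuk

/-!
# Stub `stub_kwPartition` — crux `RazWigdersonMatching` (stmt-ValiantsHypothesis-17127), line `Sketch`

Registered stub `stub_kwPartition` (shared verbatim by the lines `Sketch`, `Sketch-one-run-slack`
and `rothvoss_planted` of the crux
`Summit.ValiantsHypothesis.ValiantsHypothesis.Theses.ShallowShadows.RazWigdersonMatching`, route
`ShallowShadows`): **Karchmer–Wigderson, monotone game, LEAF (partition-number) form** in the
tree's straight-line circuit model `Literature.Computability.Complexity.Circuit`.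

A formula `C` over the monotone basis `{∧₂, ∨₂}` (every gate referenced at most once,
`Circuit.IsFormula`) with `C.size` gates computing `f` yields `L ≤ C.size + 1` "leaf rectangles"
`A l × B l ⊆ {0,1}^ι × {0,1}^ι`, each labelled by a variable `lab l`, such that every pair
`(x, y)` with `f x = 1`, `f y = 0` lies in EXACTLY ONE rectangle, and on such pairs of `A l × B l`
the label is a valid answer of the monotone Karchmer–Wigderson game: `x (lab l) = 1`,
`y (lab l) = 0` (Karchmer–Wigderson 1990; Rao–Yehudayoff, *Communication Complexity*, Lemma 9.2
and the remark after it; the leaves of a protocol tree are disjoint rectangles — Rychkov's lemma,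
Jukna 2012 §3.3).

Proof (no depth, no balancing, no tree extraction). Write `HP h L` for "the monotone KW game of
`h` has a labelled rectangle partition with `L` parts" (kept inline, no definition is introduced).
* `HP xᵢ 1` (`kwPart_input`); `HP g L₁ → HP h L₂ → HP (g ∨ h) (L₁ + L₂)` (`kwPart_or`: Alice's
  side is split into `{g = 1}` and `{g = 0}`), and dually `HP (g ∧ h) (L₁ + L₂)` (`kwPart_and`:
  Bob's side is split into `{g = 0}` and `{g = 1}`).
* Additive potential over the straight-line program (after the multiplicative potential of
  `MonotoneNechiporuk.lean`): with `ν(j) = min {k | HP (wire j) (k + 1)}` and `U_m` the gates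
  `< m` not referenced by gates `< m` (`Circuit.unusedBelow`), `Σ_{j ∈ U_{m+1}} ν(j) ≤ 1 +
  Σ_{j ∈ U_m} ν(j)`, because gate `m` consumes its distinct, previously unreferenced gate
  arguments (`ν(u ⋄ v) ≤ ν(u) + ν(v) + 1`, this is where `IsFormula` enters) and variable
  arguments cost `ν = 0`. Hence `ν(output) ≤ Σ_{U_{o+1}} ν ≤ o + 1 ≤ C.size`, i.e. the computed
  function has a partition with `≤ C.size + 1` parts.

[cite: KarchmerWigderson1990, §2, Thm. (d_m(f) = C(R_f^m))]
[cite: JuknaBFC2012, §3.3 (Rychkov's lemma; protocol leaves are disjoint rectangles)]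
-/

set_option linter.dupNamespace false -- single-conjunct summit: `ValiantsHypothesis.ValiantsHypothesis`

noncomputable section

namespace Summit.ValiantsHypothesis.ValiantsHypothesis.Theorems.ShallowShadowsRazWigdersonMatching

open Finset
open Literature.Computability.Complexity Literature.Computability.Complexity.Circuit

universe u

variable {ι : Type u}

/-! ### The three closure properties of labelled rectangle partitions -/

/-- A variable `xᵢ` has the one-part partition `{0,1}^ι × {0,1}^ι` labelled `i`. [folklore] -/
theorem kwPart_input (i : ι) :
    ∃ (A : Fin 1 → Set (ι → Bool)) (B : Fin 1 → Set (ι → Bool)) (lab : Fin 1 → ι),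
      (∀ x y, x i = true → y i = false → ∃! l, x ∈ A l ∧ y ∈ B l) ∧
      (∀ l x y, x ∈ A l → y ∈ B l → x i = true → y i = false →
        x (lab l) = true ∧ y (lab l) = false) := by
  refine ⟨fun _ => Set.univ, fun _ => Set.univ, fun _ => i, ?_, ?_⟩
  · intro x y _ _
    exact ⟨0, ⟨Set.mem_univ _, Set.mem_univ _⟩, fun l _ => Subsingleton.elim l 0⟩
  · intro _ x y _ _ hx hy
    exact ⟨hx, hy⟩

/-- **Disjunction step** (Alice splits): partitions for `g` with `L₁` parts and for `h` with `L₂`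
parts give a partition for `g ∨ h` with `L₁ + L₂` parts — the `g`-rectangles restricted to
`{x | g x = 1}` on Alice's side, followed by the `h`-rectangles restricted to `{x | g x = 0}`.
[cite: JuknaBFC2012, §3.3 (proof of Thm. 3.13 / Rychkov's lemma)] -/
theorem kwPart_or {g h : (ι → Bool) → Bool} {L₁ L₂ : ℕ}
    (hg : ∃ (A : Fin L₁ → Set (ι → Bool)) (B : Fin L₁ → Set (ι → Bool)) (lab : Fin L₁ → ι),
      (∀ x y, g x = true → g y = false → ∃! l, x ∈ A l ∧ y ∈ B l) ∧
      (∀ l x y, x ∈ A l → y ∈ B l → g x = true → g y = false →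
        x (lab l) = true ∧ y (lab l) = false))
    (hh : ∃ (A : Fin L₂ → Set (ι → Bool)) (B : Fin L₂ → Set (ι → Bool)) (lab : Fin L₂ → ι),
      (∀ x y, h x = true → h y = false → ∃! l, x ∈ A l ∧ y ∈ B l) ∧
      (∀ l x y, x ∈ A l → y ∈ B l → h x = true → h y = false →
        x (lab l) = true ∧ y (lab l) = false)) :
    ∃ (A : Fin (L₁ + L₂) → Set (ι → Bool)) (B : Fin (L₁ + L₂) → Set (ι → Bool))
      (lab : Fin (L₁ + L₂) → ι),
      (∀ x y, (g x || h x) = true → (g y || h y) = false → ∃! l, x ∈ A l ∧ y ∈ B l) ∧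
      (∀ l x y, x ∈ A l → y ∈ B l → (g x || h x) = true → (g y || h y) = false →
        x (lab l) = true ∧ y (lab l) = false) := by
  obtain ⟨A₁, B₁, lab₁, hp₁, hv₁⟩ := hg
  obtain ⟨A₂, B₂, lab₂, hp₂, hv₂⟩ := hh
  refine ⟨Fin.append (fun l => A₁ l ∩ {x | g x = true}) (fun l => A₂ l ∩ {x | g x = false}),
    Fin.append B₁ B₂, Fin.append lab₁ lab₂, ?_, ?_⟩
  · intro x y hx hy
    rw [Bool.or_eq_false_iff] at hy
    cases hgx : g x
    · -- `g x = 0`, so `h x = 1`: the `h`-part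
      have hhx : h x = true := by simpa [hgx] using hx
      obtain ⟨l₂, ⟨hxA, hyB⟩, huniq⟩ := hp₂ x y hhx hy.2
      refine ⟨Fin.natAdd L₁ l₂, ?_, ?_⟩
      · refine ⟨?_, ?_⟩
        · rw [Fin.append_right]
          exact ⟨hxA, hgx⟩
        · rw [Fin.append_right]
          exact hyB
      · intro l' hl'
        induction l' using Fin.addCases with
        | left i =>
          rw [Fin.append_left] at hl'
          have : g x = true := hl'.1.2
          rw [hgx] at this
          exact Bool.noConfusion this
        | right i =>
          rw [Fin.append_right, Fin.append_right] at hl'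
          have := huniq i ⟨hl'.1.1, hl'.2⟩
          rw [this]
    · -- `g x = 1`: the `g`-part
      obtain ⟨l₁, ⟨hxA, hyB⟩, huniq⟩ := hp₁ x y hgx hy.1
      refine ⟨Fin.castAdd L₂ l₁, ?_, ?_⟩
      · refine ⟨?_, ?_⟩
        · rw [Fin.append_left]
          exact ⟨hxA, hgx⟩
        · rw [Fin.append_left]
          exact hyB
      · intro l' hl'
        induction l' using Fin.addCases with
        | left i =>
          rw [Fin.append_left, Fin.append_left] at hl'
          have := huniq i ⟨hl'.1.1, hl'.2⟩
          rw [this]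
        | right i =>
          rw [Fin.append_right] at hl'
          have : g x = false := hl'.1.2
          rw [hgx] at this
          exact Bool.noConfusion this
  · intro l x y hxA hyB hx hy
    rw [Bool.or_eq_false_iff] at hy
    induction l using Fin.addCases with
    | left i =>
      rw [Fin.append_left] at hxA hyB
      rw [Fin.append_left]
      exact hv₁ i x y hxA.1 hyB hxA.2 hy.1
    | right i =>
      rw [Fin.append_right] at hxA hyB
      rw [Fin.append_right]
      have hgx : g x = false := hxA.2
      have hhx : h x = true := by simpa [hgx] using hx
      exact hv₂ i x y hxA.1 hyB hhx hy.2

/-- **Conjunction step** (Bob splits): partitions for `g` with `L₁` parts and for `h` with `L₂`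
parts give a partition for `g ∧ h` with `L₁ + L₂` parts — the `g`-rectangles restricted to
`{y | g y = 0}` on Bob's side, followed by the `h`-rectangles restricted to `{y | g y = 1}`.
[cite: JuknaBFC2012, §3.3 (proof of Thm. 3.13 / Rychkov's lemma)] -/
theorem kwPart_and {g h : (ι → Bool) → Bool} {L₁ L₂ : ℕ}
    (hg : ∃ (A : Fin L₁ → Set (ι → Bool)) (B : Fin L₁ → Set (ι → Bool)) (lab : Fin L₁ → ι),
      (∀ x y, g x = true → g y = false → ∃! l, x ∈ A l ∧ y ∈ B l) ∧
      (∀ l x y, x ∈ A l → y ∈ B l → g x = true → g y = false →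
        x (lab l) = true ∧ y (lab l) = false))
    (hh : ∃ (A : Fin L₂ → Set (ι → Bool)) (B : Fin L₂ → Set (ι → Bool)) (lab : Fin L₂ → ι),
      (∀ x y, h x = true → h y = false → ∃! l, x ∈ A l ∧ y ∈ B l) ∧
      (∀ l x y, x ∈ A l → y ∈ B l → h x = true → h y = false →
        x (lab l) = true ∧ y (lab l) = false)) :
    ∃ (A : Fin (L₁ + L₂) → Set (ι → Bool)) (B : Fin (L₁ + L₂) → Set (ι → Bool))
      (lab : Fin (L₁ + L₂) → ι),
      (∀ x y, (g x && h x) = true → (g y && h y) = false → ∃! l, x ∈ A l ∧ y ∈ B l) ∧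
      (∀ l x y, x ∈ A l → y ∈ B l → (g x && h x) = true → (g y && h y) = false →
        x (lab l) = true ∧ y (lab l) = false) := by
  obtain ⟨A₁, B₁, lab₁, hp₁, hv₁⟩ := hg
  obtain ⟨A₂, B₂, lab₂, hp₂, hv₂⟩ := hh
  refine ⟨Fin.append A₁ A₂,
    Fin.append (fun l => B₁ l ∩ {y | g y = false}) (fun l => B₂ l ∩ {y | g y = true}),
    Fin.append lab₁ lab₂, ?_, ?_⟩
  · intro x y hx hy
    rw [Bool.and_eq_true] at hx
    cases hgy : g y
    · -- `g y = 0`: the `g`-part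
      obtain ⟨l₁, ⟨hxA, hyB⟩, huniq⟩ := hp₁ x y hx.1 hgy
      refine ⟨Fin.castAdd L₂ l₁, ?_, ?_⟩
      · refine ⟨?_, ?_⟩
        · rw [Fin.append_left]
          exact hxA
        · rw [Fin.append_left]
          exact ⟨hyB, hgy⟩
      · intro l' hl'
        induction l' using Fin.addCases with
        | left i =>
          rw [Fin.append_left, Fin.append_left] at hl'
          have := huniq i ⟨hl'.1, hl'.2.1⟩
          rw [this]
        | right i =>
          rw [Fin.append_right, Fin.append_right] at hl'
          have : g y = true := hl'.2.2
          rw [hgy] at this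
          exact Bool.noConfusion this
    · -- `g y = 1`, so `h y = 0`: the `h`-part
      have hhy : h y = false := by simpa [hgy] using hy
      obtain ⟨l₂, ⟨hxA, hyB⟩, huniq⟩ := hp₂ x y hx.2 hhy
      refine ⟨Fin.natAdd L₁ l₂, ?_, ?_⟩
      · refine ⟨?_, ?_⟩
        · rw [Fin.append_right]
          exact hxA
        · rw [Fin.append_right]
          exact ⟨hyB, hgy⟩
      · intro l' hl'
        induction l' using Fin.addCases with
        | left i =>
          rw [Fin.append_left, Fin.append_left] at hl'
          have : g y = false := hl'.2.2
          rw [hgy] at this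
          exact Bool.noConfusion this
        | right i =>
          rw [Fin.append_right, Fin.append_right] at hl'
          have := huniq i ⟨hl'.1, hl'.2.1⟩
          rw [this]
  · intro l x y hxA hyB hx hy
    rw [Bool.and_eq_true] at hx
    induction l using Fin.addCases with
    | left i =>
      rw [Fin.append_left] at hxA hyB
      rw [Fin.append_left]
      exact hv₁ i x y hxA hyB.1 hx.1 hyB.2
    | right i =>
      rw [Fin.append_right] at hxA hyB
      rw [Fin.append_right]
      have hgy : g y = true := hyB.2
      have hhy : h y = false := by simpa [hgy] using hy
      exact hv₂ i x y hxA hyB.1 hx.2 hhy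

/-! ### The registered stub -/

/-- **Karchmer–Wigderson, monotone, leaf form** (registered stub `stub_kwPartition` of the crux
`RazWigdersonMatching`, shared by all its lines): a formula over `{∧₂, ∨₂}` with `C.size` gates
computing `f` yields a labelled rectangle PARTITION of `f⁻¹(1) × f⁻¹(0)` into `L ≤ C.size + 1`
parts on each of which the label is a valid monotone KW answer. Additive potential over the
straight-line program, see the module docstring.
[cite: KarchmerWigderson1990, §2, Thm. (d_m(f) = C(R_f^m))]
[cite: JuknaBFC2012, §3.3 (Rychkov's lemma)] -/
theorem stub_kwPartition :
    ∀ (ι : Type) [Fintype ι] [DecidableEq ι] (f : (ι → Bool) → Bool) (C : Circuit ι),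
      C.IsOver monotoneBasis → C.IsFormula → C.Computes f →
        ∃ L : ℕ, L ≤ C.size + 1 ∧
          ∃ (A : Fin L → Set (ι → Bool)) (B : Fin L → Set (ι → Bool)) (lab : Fin L → ι),
            (∀ x y, f x = true → f y = false → ∃! l, x ∈ A l ∧ y ∈ B l) ∧
            (∀ l x y, x ∈ A l → y ∈ B l → f x = true → f y = false →
              x (lab l) = true ∧ y (lab l) = false) := by
  intro ι _ hdec f C hO hF hcomp
  -- the partition built below is classical; the `DecidableEq ι` instance of the signature is not
  -- used (and must not shadow the classical instances of the `unusedBelow` lemmas)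
  clear hdec
  classical
  -- `HP h L`: the monotone KW game of `h` has a labelled rectangle partition with `L` parts
  let HP : ((ι → Bool) → Bool) → ℕ → Prop := fun h L =>
    ∃ (A : Fin L → Set (ι → Bool)) (B : Fin L → Set (ι → Bool)) (lab : Fin L → ι),
      (∀ x y, h x = true → h y = false → ∃! l, x ∈ A l ∧ y ∈ B l) ∧
      (∀ l x y, x ∈ A l → y ∈ B l → h x = true → h y = false →
        x (lab l) = true ∧ y (lab l) = false)
  have hcast : ∀ (h : (ι → Bool) → Bool) (L L' : ℕ), HP h L → L = L' → HP h L' := by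
    rintro h L L' hp rfl
    exact hp
  have hinput : ∀ i : ι, HP (fun x => x i) 1 := fun i => kwPart_input i
  have hor : ∀ (g h : (ι → Bool) → Bool) (L₁ L₂ : ℕ), HP g L₁ → HP h L₂ →
      HP (fun x => (g x || h x)) (L₁ + L₂) := fun g h L₁ L₂ hg hh => kwPart_or hg hh
  have hand : ∀ (g h : (ι → Bool) → Bool) (L₁ L₂ : ℕ), HP g L₁ → HP h L₂ →
      HP (fun x => (g x && h x)) (L₁ + L₂) := fun g h L₁ L₂ hg hh => kwPart_and hg hh
  -- the gate equation over `{∧₂, ∨₂}`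
  have hgateEq : ∀ (m : ℕ) (hm : m < C.gates.length), ∃ (args : Fin 2 → ι ⊕ ℕ)
      (op : (Fin 2 → Bool) → Bool), C.gates[m] = ⟨2, op, args⟩ ∧
      ((C.wireFn (.inr m) = fun x => (C.wireFn (args 0) x && C.wireFn (args 1) x)) ∨
        (C.wireFn (.inr m) = fun x => (C.wireFn (args 0) x || C.wireFn (args 1) x))) := by
    intro m hm
    obtain ⟨op, args, hg, hop⟩ :=
      Gate.exists_eq_of_fn_mem_monotoneBasis (hO _ (List.getElem_mem hm))
    refine ⟨args, op, hg, ?_⟩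
    rcases hop with rfl | rfl
    · left; funext x; rw [C.wireFn_inr hm, hg, gateValue_and_two]; rfl
    · right; funext x; rw [C.wireFn_inr hm, hg, gateValue_or_two]; rfl
  -- existence of partitions for every gate wire, by induction along the program
  have hex : ∀ m, m ≤ C.gates.length → ∀ j < m, ∃ k, HP (C.wireFn (.inr j)) (k + 1) := by
    intro m
    induction m with
    | zero => intro _ j hj; exact absurd hj (Nat.not_lt_zero j)
    | succ m ih =>
      intro hm j hj
      have hm' : m < C.gates.length := hm
      have ih' := ih hm'.le
      rcases Nat.lt_succ_iff_lt_or_eq.1 hj with hjm | rfl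
      · exact ih' j hjm
      · -- the new gate `m`
        obtain ⟨args, op, hg, hw⟩ := hgateEq j hm'
        -- partitions for the two argument wires
        have harg : ∀ a : Fin 2, ∃ k, HP (C.wireFn (args a)) (k + 1) := by
          intro a
          rcases ha : args a with i | j'
          · exact ⟨0, by rw [C.wireFn_inl]; exact hinput i⟩
          · have hj' : j' < j :=
              (mem_unusedBelow.1 (mem_filter.1 (hF.arg_mem_filter_unusedBelow hm' hg a ha)).1).1
            exact ih' j' hj'
        obtain ⟨k₀, hk₀⟩ := harg 0
        obtain ⟨k₁, hk₁⟩ := harg 1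
        refine ⟨k₀ + k₁ + 1, ?_⟩
        rcases hw with hw | hw <;> rw [hw]
        · exact hcast _ _ _ (hand _ _ _ _ hk₀ hk₁) (by ring)
        · exact hcast _ _ _ (hor _ _ _ _ hk₀ hk₁) (by ring)
  -- the measure `ν(j) = min {k | HP (wire j) (k+1)}` and its attainment
  let K : ℕ → ℕ := fun j => sInf {k | HP (C.wireFn (.inr j)) (k + 1)}
  have hK : ∀ j < C.gates.length, HP (C.wireFn (.inr j)) (K j + 1) := fun j hj =>
    Nat.sInf_mem (hex C.gates.length le_rfl j hj)
  have hKle : ∀ j k, HP (C.wireFn (.inr j)) (k + 1) → K j ≤ k := fun j k hk =>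
    Nat.sInf_le hk
  -- the cost of a wire: `0` for a variable, `ν(j)` for gate `j`
  let K' : ι ⊕ ℕ → ℕ := fun w => Sum.elim (fun _ => 0) K w
  -- gate step for the measure: `ν(m) ≤ ν'(u) + ν'(v) + 1`
  have hgate : ∀ (m : ℕ) (hm : m < C.gates.length) (args : Fin 2 → ι ⊕ ℕ) (op),
      C.gates[m] = ⟨2, op, args⟩ →
      ((C.wireFn (.inr m) = fun x => (C.wireFn (args 0) x && C.wireFn (args 1) x)) ∨
        (C.wireFn (.inr m) = fun x => (C.wireFn (args 0) x || C.wireFn (args 1) x))) →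
      K m ≤ K' (args 0) + K' (args 1) + 1 := by
    intro m hm args op hg hw
    have harg : ∀ a : Fin 2, HP (C.wireFn (args a)) (K' (args a) + 1) := by
      intro a
      rcases ha : args a with i | j'
      · rw [C.wireFn_inl]; exact hinput i
      · have hj' : j' < m :=
          (mem_unusedBelow.1 (mem_filter.1 (hF.arg_mem_filter_unusedBelow hm hg a ha)).1).1
        exact hK j' (hj'.trans hm)
    apply hKle
    rcases hw with hw | hw <;> rw [hw]
    · exact hcast _ _ _ (hand _ _ _ _ (harg 0) (harg 1)) (by ring)
    · exact hcast _ _ _ (hor _ _ _ _ (harg 0) (harg 1)) (by ring)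
  -- the potential `Φ_m = Σ_{j ∈ U_m} ν(j)` and its step `Φ_{m+1} ≤ Φ_m + 1`
  have hstep : ∀ (m : ℕ), m < C.gates.length →
      ∑ j ∈ C.unusedBelow (m + 1), K j ≤ (∑ j ∈ C.unusedBelow m, K j) + 1 := by
    intro m hm
    obtain ⟨args, op, hg, hw⟩ := hgateEq m hm
    set P : ℕ → Prop := fun j => ∀ a : Fin (C.gates[m]).arity, (C.gates[m]).args a ≠ .inr j
      with hP
    set Bsum := ∑ j ∈ (C.unusedBelow m).filter (fun j => ¬ P j), K j with hB
    have hmem : ∀ (a : Fin 2) (j : ℕ), args a = .inr j →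
        j ∈ (C.unusedBelow m).filter (fun j => ¬ P j) := fun a j ha =>
      hF.arg_mem_filter_unusedBelow hm hg a ha
    have hle_one : ∀ j, j ∈ (C.unusedBelow m).filter (fun j => ¬ P j) → K j ≤ Bsum :=
      fun j hj => single_le_sum (f := K) (fun _ _ => Nat.zero_le _) hj
    -- the new gate costs at most `Bsum + 1`
    have hnew : K m ≤ Bsum + 1 := by
      refine (hgate m hm args op hg hw).trans ?_
      rcases h0 : args 0 with i | j <;> rcases h1 : args 1 with i' | j'
      · change 0 + 0 + 1 ≤ Bsum + 1; omega
      · change 0 + K j' + 1 ≤ Bsum + 1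
        have := hle_one j' (hmem 1 j' h1); omega
      · change K j + 0 + 1 ≤ Bsum + 1
        have := hle_one j (hmem 0 j h0); omega
      · change K j + K j' + 1 ≤ Bsum + 1
        have hne : j ≠ j' := hF.ne_of_args hm hg (show (0 : Fin 2) ≠ 1 by decide) h0 h1
        have hsub : ({j, j'} : Finset ℕ) ⊆ (C.unusedBelow m).filter (fun j => ¬ P j) := by
          intro b hb
          simp only [mem_insert, mem_singleton] at hb
          rcases hb with rfl | rfl
          · exact hmem 0 _ h0
          · exact hmem 1 _ h1
        have h2 : K j + K j' = ∑ b ∈ ({j, j'} : Finset ℕ), K b := (sum_pair hne).symm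
        have h3 : ∑ b ∈ ({j, j'} : Finset ℕ), K b ≤ Bsum :=
          sum_le_sum_of_subset_of_nonneg hsub fun _ _ _ => Nat.zero_le _
        omega
    rw [C.unusedBelow_succ hm, sum_insert (fun h => C.not_mem_unusedBelow_self m (mem_filter.1 h).1)]
    calc K m + ∑ j ∈ (C.unusedBelow m).filter
            (fun j => ∀ a : Fin (C.gates[m]).arity, (C.gates[m]).args a ≠ .inr j), K j
        = K m + ∑ j ∈ (C.unusedBelow m).filter P, K j := rfl
      _ ≤ (Bsum + 1) + ∑ j ∈ (C.unusedBelow m).filter P, K j := Nat.add_le_add_right hnew _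
      _ = (∑ j ∈ (C.unusedBelow m).filter P, K j + Bsum) + 1 := by ring
      _ = ∑ j ∈ C.unusedBelow m, K j + 1 := by rw [sum_filter_add_sum_filter_not]
  have hpot : ∀ m, m ≤ C.gates.length → ∑ j ∈ C.unusedBelow m, K j ≤ m := by
    intro m
    induction m with
    | zero => intro _; simp [Circuit.unusedBelow]
    | succ m ih =>
      intro hm
      exact (hstep m hm).trans (by have := ih (Nat.le_of_succ_le hm); omega)
  -- conclusion: the output wire
  have hfin : ∃ L : ℕ, L ≤ C.size + 1 ∧ HP C.eval L := by
    rw [C.eval_eq_wireFn]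
    cases hco : C.output with
    | inl i =>
      exact ⟨1, by omega, by rw [C.wireFn_inl]; exact hinput i⟩
    | inr o =>
      have ho := C.wf_output o hco
      refine ⟨K o + 1, ?_, hK o ho⟩
      have h1 : K o ≤ ∑ j ∈ C.unusedBelow (o + 1), K j :=
        single_le_sum (f := K) (fun _ _ => Nat.zero_le _) (C.mem_unusedBelow_succ_self o)
      have h2 := hpot (o + 1) ho
      change K o + 1 ≤ C.gates.length + 1
      omega
  obtain ⟨L, hL, hp⟩ := hfin
  have hfe : C.eval = f := funext hcomp
  rw [hfe] at hp
  exact ⟨L, hL, hp⟩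

end Summit.ValiantsHypothesis.ValiantsHypothesis.Theorems.ShallowShadowsRazWigdersonMatching

end
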